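import Mathlib
import Summits.ValiantsHypothesis.ValiantsHypothesis.Theorems.LacunarySymmetroidMatrixDescartesDetLorentzianHessianTwo
import Summits.ValiantsHypothesis.ValiantsHypothesis.Theorems.LacunarySymmetroidMatrixDescartesDetLorentzianHyperbolicQuadratic
import HarnessLib

/-!
# ValiantsHypothesis / LacunarySymmetroid — crux `MatrixDescartes` (stmt-ValiantsHypothesis-18050, V1),
# line `Cruxes/MatrixDescartes/Lines/lorentzian_shadow.lean`: the line's Hessian `hessAt c γ` IS the Hessian of
# the iterated partial derivative `∂^γ P`

Conjunct (d) of the line's `IsLorentzianArray m K c` concerns the matrices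
`hessAt c γ (i,j) = (γ+e_i+e_j)! · c(γ+e_i+e_j)` (`(α)! = ∏_k α_k!`), `γ ∈ Δ(m−2, K)`, for the coefficient array
`c_α = [s^α] P`.  THIS FILE identifies them with honest derivatives (`0` named facts, no definitions), for an
ARBITRARY `P ∈ ℝ[s_1..s_K]`:

* `coeff_foldr_pderiv_mul` — for a word `L = [l₁,…,l_n]` and `∂_L P := ∂_{l₁} ⋯ ∂_{l_n} P`
  (`List.foldr pderiv`): `β! · [s^β] ∂_L P = (β + γ)! · [s^{β+γ}] P` with `γ = cnt L` the letter count
  (Mathlib `MvPolynomial.coeff_pderiv`, induction on the word);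
* `isHomogeneous_foldr_pderiv` — `∂_L` lowers the degree of a form by `|L|`;
* `polarization_eq` — for ANY quadratic form `Q`: `Q(v+w) − Q(v) − Q(w) = Σ_{i,j} v_i w_j (e_i+e_j)! [s^{e_i+e_j}] Q`
  (the Hessian bilinear form; monomial-by-monomial, `exists_pair_of_degree_two`, `sum_sum_ite_pair`);
* **`dotProduct_hessAt_mulVec`**, **`dotProduct_hessAt_mulVec_self`** — hence, for a form `P` of degree
  `|L| + 2` and `γ` the letter count of `L`: `vᵀ (hessAt c γ) w = Q(v+w) − Q(v) − Q(w)` and `vᵀ (hessAt c γ) v = 2 Q(v)`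
  with `Q = ∂_L P`, the line's `hessAt`/`factWeight`/coefficient encoding UNFOLDED (functions `Fin K → ℕ`,
  `Finsupp.equivFunOnFinite.symm`), exactly as it appears inside `IsLorentzianArray m K (detArray m K A)`.

With `…DetLorentzianHyperbolicQuadratic.lean` (hyperbolic quadratics are Lorentzian) and Gårding–Rolle along the
PSD cone this yields conjunct (d) for definite tuples (sibling file `…DetLorentzianHessianDefinite.lean`).
Honest framing: pure coefficient algebra; `stub_detLorentzian`, the laws, `MatrixDescartes`, Conjecture B and
`VP ≠ VNP` stay OPEN here.
-/

-- `Summit.ValiantsHypothesis.ValiantsHypothesis.…` is the tree's mandated single-conjunct layout (Sub = Summit).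
set_option linter.dupNamespace false

noncomputable section

namespace Summit.ValiantsHypothesis.ValiantsHypothesis.Theorems.LacunarySymmetroidMatrixDescartes

open MvPolynomial Finset Matrix
open scoped BigOperators

namespace DetLorentzianHessianPderiv

variable {K : ℕ}

/-! ### Multifactorials and iterated partial derivatives -/

/-- `(β + e_l)! = (β_l + 1) · β!` for the multifactorial `β! = ∏_k β_k!`. [folklore] -/
theorem mf_add_single (β : Fin K →₀ ℕ) (l : Fin K) :
    (∏ k, ((β + Finsupp.single l 1 : Fin K →₀ ℕ) k).factorial) = (β l + 1) * ∏ k, (β k).factorial := by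
  classical
  rw [← Finset.mul_prod_erase Finset.univ _ (Finset.mem_univ l),
    ← Finset.mul_prod_erase Finset.univ (fun k => (β k).factorial) (Finset.mem_univ l)]
  have h1 : ((β + Finsupp.single l 1 : Fin K →₀ ℕ) l).factorial = (β l + 1) * (β l).factorial := by
    rw [Finsupp.add_apply, Finsupp.single_eq_same, Nat.factorial_succ]
  have h2 : ∏ k ∈ Finset.univ.erase l, ((β + Finsupp.single l 1 : Fin K →₀ ℕ) k).factorial =
      ∏ k ∈ Finset.univ.erase l, (β k).factorial := by
    refine Finset.prod_congr rfl fun k hk => ?_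
    rw [Finsupp.add_apply, Finsupp.single_apply, if_neg (Finset.ne_of_mem_erase hk).symm, add_zero]
  rw [h1, h2, mul_assoc]

/-- **Coefficients of an iterated partial derivative**: for a word `L` with letter count `γ = Σ_{l∈L} e_l`,
`β! · [s^β] (∂_L P) = (β+γ)! · [s^{β+γ}] P`. [folklore] -/
theorem coeff_foldr_pderiv_mul (P : MvPolynomial (Fin K) ℝ) :
    ∀ (L : List (Fin K)) (β : Fin K →₀ ℕ),
      MvPolynomial.coeff β (L.foldr (fun l g => MvPolynomial.pderiv l g) P) * ((∏ k, (β k).factorial : ℕ) : ℝ) =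
        ((∏ k, ((β + (L.map fun l => Finsupp.single l 1).sum : Fin K →₀ ℕ) k).factorial : ℕ) : ℝ) *
          MvPolynomial.coeff (β + (L.map fun l => Finsupp.single l 1).sum) P := by
  intro L
  induction L with
  | nil =>
    intro β
    simp only [List.foldr_nil, List.map_nil, List.sum_nil, add_zero]
    rw [mul_comm]
  | cons l L ih =>
    intro β
    rw [List.foldr_cons, MvPolynomial.coeff_pderiv, List.map_cons, List.sum_cons, ← add_assoc,
      ← ih (β + Finsupp.single l 1), mf_add_single]
    push_cast
    ring

/-- Iterated partial derivatives lower the degree of a form by the length of the word. [folklore] -/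
theorem isHomogeneous_foldr_pderiv (L : List (Fin K)) :
    ∀ (n : ℕ) (P : MvPolynomial (Fin K) ℝ), P.IsHomogeneous (n + L.length) →
      (L.foldr (fun l g => MvPolynomial.pderiv l g) P).IsHomogeneous n := by
  induction L with
  | nil => intro n P hP; simpa using hP
  | cons l L ih =>
    intro n P hP
    rw [List.foldr_cons]
    have hlen : n + 1 + L.length = n + (l :: L).length := by rw [List.length_cons]; omega
    have h := (ih (n + 1) P (by rwa [hlen])).pderiv (i := l)
    simpa using h

/-- The letter count of a word, coordinatewise: `(Σ_{l∈L} e_l)_a = #{occurrences of a in L}`. [folklore] -/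
theorem sum_map_single_apply (L : List (Fin K)) (a : Fin K) :
    ((L.map fun l => (Finsupp.single l 1 : Fin K →₀ ℕ)).sum) a = L.count a := by
  classical
  induction L with
  | nil => simp
  | cons l L ih =>
    rw [List.map_cons, List.sum_cons, Finsupp.add_apply, ih, List.count_cons, Finsupp.single_apply]
    by_cases h : l = a
    · subst h; simp [add_comm]
    · simp [h]

/-! ### The Hessian bilinear form of a quadratic -/

/-- An exponent of degree `2` is `e_a + e_b`. [folklore] -/
theorem exists_pair_of_degree_two {d : Fin K →₀ ℕ} (hd : d.degree = 2) :
    ∃ a b : Fin K, d = Finsupp.single a 1 + Finsupp.single b 1 := by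
  classical
  have hcard : Multiset.card (Finsupp.toMultiset d) = 2 := by
    rw [Finsupp.card_toMultiset, ← hd, Finsupp.degree_apply]
    rfl
  obtain ⟨a, b, hab⟩ := Multiset.card_eq_two.1 hcard
  refine ⟨a, b, ?_⟩
  rw [← Finsupp.toMultiset_toFinsupp d, hab, Multiset.insert_eq_cons, ← Multiset.singleton_add,
    Multiset.toFinsupp_add, Multiset.toFinsupp_singleton, Multiset.toFinsupp_singleton]

/-- Double sums against the indicator of `e_i + e_j = e_a + e_b`. [folklore] -/
theorem sum_sum_ite_pair (F : Fin K → Fin K → ℝ) (a b : Fin K) :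
    (∑ i, ∑ j, if Finsupp.single i 1 + Finsupp.single j 1 =
        (Finsupp.single a 1 + Finsupp.single b 1 : Fin K →₀ ℕ) then F i j else 0) =
      if a = b then F a a else F a b + F b a := by
  classical
  have key : ∀ i j : Fin K, (Finsupp.single i 1 + Finsupp.single j 1 =
      (Finsupp.single a 1 + Finsupp.single b 1 : Fin K →₀ ℕ)) ↔ (i = a ∧ j = b) ∨ (i = b ∧ j = a) := by
    intro i j
    rw [Finsupp.single_add_single_eq_single_add_single one_ne_zero one_ne_zero]
    simp
  simp_rw [key]
  by_cases hab : a = b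
  · subst hab
    simp only [or_self, if_true]
    rw [Finset.sum_eq_single a (fun i _ hi => by simp [hi]) (by simp),
      Finset.sum_eq_single a (fun j _ hj => by simp [hj]) (by simp)]
    simp
  · rw [if_neg hab, Finset.sum_eq_add a b hab (fun i _ hi => by simp [hi.1, hi.2]) (by simp) (by simp)]
    congr 1
    · rw [Finset.sum_eq_single b (fun j _ hj => by simp [hj, hab]) (by simp)]
      simp
    · rw [Finset.sum_eq_single a (fun j _ hj => by simp [hj, Ne.symm hab]) (by simp)]
      simp [Ne.symm hab]

/-- Evaluation of a quadratic monomial: `(r · s_a s_b)(x) = r x_a x_b`. [folklore] -/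
theorem eval_monomial_pair (a b : Fin K) (r : ℝ) (x : Fin K → ℝ) :
    MvPolynomial.eval x (MvPolynomial.monomial (Finsupp.single a 1 + Finsupp.single b 1) r) = r * (x a * x b) := by
  classical
  rw [MvPolynomial.eval_monomial, Finsupp.prod_add_index' (fun _ => pow_zero _) (fun _ _ _ => pow_add _ _ _),
    Finsupp.prod_single_index ?_, Finsupp.prod_single_index ?_, pow_one, pow_one]
  · exact pow_zero _
  · exact pow_zero _

/-- The normalising factor on a pair of unit vectors: `(e_i+e_j)! = 2^{[i=j]}` (finsupp form of
`DetLorentzianHessianTwo.factWeight_pair`). [folklore] -/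
theorem mf_pair (i j : Fin K) :
    (∏ k, ((Finsupp.single i 1 + Finsupp.single j 1 : Fin K →₀ ℕ) k).factorial) = if i = j then 2 else 1 := by
  classical
  rw [← DetLorentzianHessianTwo.factWeight_pair i j]
  refine Finset.prod_congr rfl fun k _ => ?_
  rw [Finsupp.coe_add, Finsupp.single_eq_pi_single, Finsupp.single_eq_pi_single]

/-- **Polarisation of a quadratic form through its coefficients** (the Hessian bilinear form):
`Q(v+w) − Q(v) − Q(w) = Σ_{i,j} v_i w_j · (e_i+e_j)! · [s^{e_i+e_j}] Q`. [folklore] -/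
theorem polarization_eq {Q : MvPolynomial (Fin K) ℝ} (hQ : Q.IsHomogeneous 2) (v w : Fin K → ℝ) :
    MvPolynomial.eval (v + w) Q - MvPolynomial.eval v Q - MvPolynomial.eval w Q =
      ∑ i, ∑ j, v i * w j *
        ((((∏ k, ((Finsupp.single i 1 + Finsupp.single j 1 : Fin K →₀ ℕ) k).factorial : ℕ) : ℝ)) *
          MvPolynomial.coeff (Finsupp.single i 1 + Finsupp.single j 1) Q) := by
  classical
  have hQ' : Q = ∑ d ∈ Q.support, MvPolynomial.monomial d (MvPolynomial.coeff d Q) := Q.as_sum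
  -- the left-hand side, monomial by monomial
  have lhs : MvPolynomial.eval (v + w) Q - MvPolynomial.eval v Q - MvPolynomial.eval w Q =
      ∑ d ∈ Q.support, (MvPolynomial.eval (v + w) (MvPolynomial.monomial d (MvPolynomial.coeff d Q)) -
        MvPolynomial.eval v (MvPolynomial.monomial d (MvPolynomial.coeff d Q)) -
        MvPolynomial.eval w (MvPolynomial.monomial d (MvPolynomial.coeff d Q))) := by
    rw [Finset.sum_sub_distrib, Finset.sum_sub_distrib, ← map_sum, ← map_sum, ← map_sum, ← hQ']
  -- the right-hand side, monomial by monomial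
  have hcoeff : ∀ i j : Fin K, MvPolynomial.coeff (Finsupp.single i 1 + Finsupp.single j 1) Q =
      ∑ d ∈ Q.support, if d = Finsupp.single i 1 + Finsupp.single j 1 then MvPolynomial.coeff d Q else 0 := by
    intro i j
    conv_lhs => rw [hQ']
    rw [MvPolynomial.coeff_sum]
    exact Finset.sum_congr rfl fun d _ => MvPolynomial.coeff_monomial _ _ _
  have rhs : (∑ i, ∑ j, v i * w j *
      ((((∏ k, ((Finsupp.single i 1 + Finsupp.single j 1 : Fin K →₀ ℕ) k).factorial : ℕ) : ℝ)) *
        MvPolynomial.coeff (Finsupp.single i 1 + Finsupp.single j 1) Q)) =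
      ∑ d ∈ Q.support, ∑ i, ∑ j,
        (if Finsupp.single i 1 + Finsupp.single j 1 = d then
          v i * w j * ((((∏ k, ((Finsupp.single i 1 + Finsupp.single j 1 : Fin K →₀ ℕ) k).factorial : ℕ) : ℝ)) *
            MvPolynomial.coeff d Q)
          else 0) := by
    calc (∑ i, ∑ j, v i * w j *
          ((((∏ k, ((Finsupp.single i 1 + Finsupp.single j 1 : Fin K →₀ ℕ) k).factorial : ℕ) : ℝ)) *
            MvPolynomial.coeff (Finsupp.single i 1 + Finsupp.single j 1) Q))
        = ∑ i, ∑ j, ∑ d ∈ Q.support,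
            (if Finsupp.single i 1 + Finsupp.single j 1 = d then
              v i * w j * ((((∏ k, ((Finsupp.single i 1 + Finsupp.single j 1 : Fin K →₀ ℕ) k).factorial : ℕ) :
                ℝ)) * MvPolynomial.coeff d Q)
              else 0) := by
          refine Finset.sum_congr rfl fun i _ => Finset.sum_congr rfl fun j _ => ?_
          rw [hcoeff i j, Finset.mul_sum, Finset.mul_sum]
          refine Finset.sum_congr rfl fun d _ => ?_
          by_cases h : Finsupp.single i 1 + Finsupp.single j 1 = d
          · rw [if_pos h, if_pos h.symm]
          · rw [if_neg h, if_neg (fun h' => h h'.symm), mul_zero, mul_zero]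
      _ = ∑ i, ∑ d ∈ Q.support, ∑ j,
            (if Finsupp.single i 1 + Finsupp.single j 1 = d then
              v i * w j * ((((∏ k, ((Finsupp.single i 1 + Finsupp.single j 1 : Fin K →₀ ℕ) k).factorial : ℕ) :
                ℝ)) * MvPolynomial.coeff d Q)
              else 0) := Finset.sum_congr rfl fun i _ => Finset.sum_comm
      _ = _ := Finset.sum_comm
  rw [lhs, rhs]
  refine Finset.sum_congr rfl fun d hd => ?_
  -- `d = e_a + e_b`
  have hdeg : d.degree = 2 := by
    rw [Finsupp.degree_apply]
    exact (hQ.degree_eq_sum_deg_support hd).symm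
  obtain ⟨a, b, rfl⟩ := exists_pair_of_degree_two hdeg
  rw [sum_sum_ite_pair (fun i j => v i * w j *
      ((((∏ k, ((Finsupp.single i 1 + Finsupp.single j 1 : Fin K →₀ ℕ) k).factorial : ℕ) : ℝ)) *
        MvPolynomial.coeff (Finsupp.single a 1 + Finsupp.single b 1) Q)) a b,
    eval_monomial_pair, eval_monomial_pair, eval_monomial_pair]
  simp only [Pi.add_apply, mf_pair]
  by_cases hab : a = b
  · subst hab
    simp only [if_true]
    push_cast
    ring
  · rw [if_neg hab, if_neg hab, if_neg (Ne.symm hab)]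
    push_cast
    ring

/-! ### The line's `hessAt` is the Hessian of `∂^γ P` -/

/-- The line's index `γ + e_i + e_j` (functions `Fin K → ℕ`) as a finsupp: `e_i + e_j + cnt L` for a word `L`
with letter count `γ`. [folklore] -/
theorem equivFunOnFinite_symm_add_pair (L : List (Fin K)) (γ : Fin K → ℕ) (hγ : ∀ a, L.count a = γ a)
    (i j : Fin K) :
    Finsupp.equivFunOnFinite.symm (γ + Pi.single i 1 + Pi.single j 1 : Fin K → ℕ) =
      Finsupp.single i 1 + Finsupp.single j 1 + (L.map fun l => Finsupp.single l 1).sum := by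
  classical
  ext a
  simp only [Finsupp.coe_equivFunOnFinite_symm, Finsupp.coe_add, Pi.add_apply, Finsupp.single_eq_pi_single,
    sum_map_single_apply, hγ]
  ring

/-- **Entry identity**: `(γ+e_i+e_j)! · [s^{γ+e_i+e_j}] P = (e_i+e_j)! · [s^{e_i+e_j}] ∂_L P` for a word `L` with
letter count `γ`. [folklore] -/
theorem hessEntry_eq_coeff_foldr_pderiv (P : MvPolynomial (Fin K) ℝ) (L : List (Fin K)) (γ : Fin K → ℕ)
    (hγ : ∀ a, L.count a = γ a) (i j : Fin K) :
    ((∏ k, ((γ + Pi.single i 1 + Pi.single j 1 : Fin K → ℕ) k).factorial : ℕ) : ℝ) *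
        MvPolynomial.coeff (Finsupp.equivFunOnFinite.symm (γ + Pi.single i 1 + Pi.single j 1 : Fin K → ℕ)) P =
      (((∏ k, ((Finsupp.single i 1 + Finsupp.single j 1 : Fin K →₀ ℕ) k).factorial : ℕ) : ℝ)) *
        MvPolynomial.coeff (Finsupp.single i 1 + Finsupp.single j 1)
          (L.foldr (fun l g => MvPolynomial.pderiv l g) P) := by
  classical
  have hidx := equivFunOnFinite_symm_add_pair L γ hγ i j
  have hfun : ∀ k, (γ + Pi.single i 1 + Pi.single j 1 : Fin K → ℕ) k =
      (Finsupp.single i 1 + Finsupp.single j 1 + (L.map fun l => Finsupp.single l 1).sum : Fin K →₀ ℕ) k := by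
    intro k
    have := congrArg (fun f : Fin K →₀ ℕ => f k) hidx
    simpa only [Finsupp.coe_equivFunOnFinite_symm] using this
  rw [hidx, Finset.prod_congr rfl fun k _ => by rw [hfun k], mul_comm (((∏ k, ((Finsupp.single i 1 +
    Finsupp.single j 1 : Fin K →₀ ℕ) k).factorial : ℕ) : ℝ)), coeff_foldr_pderiv_mul P L]

/-- **The line's Hessian is the Hessian of `∂^γ P`.** For a form `P` of degree `|L| + 2` and `γ` the letter count
of the word `L`, with `Q = ∂_L P`:
`vᵀ (hessAt c γ) w = Q(v+w) − Q(v) − Q(w)` (the encoding `hessAt c γ (i,j) = (γ+e_i+e_j)!·c(γ+e_i+e_j)`,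
`c α = [s^α] P` via `Finsupp.equivFunOnFinite.symm`, UNFOLDED as in the line file). [folklore] -/
theorem dotProduct_hessAt_mulVec (P : MvPolynomial (Fin K) ℝ) (L : List (Fin K)) (γ : Fin K → ℕ)
    (hγ : ∀ a, L.count a = γ a) (hP : P.IsHomogeneous (L.length + 2)) (v w : Fin K → ℝ) :
    v ⬝ᵥ ((fun i j : Fin K =>
        ((∏ k, ((γ + Pi.single i 1 + Pi.single j 1 : Fin K → ℕ) k).factorial : ℕ) : ℝ) *
          MvPolynomial.coeff (Finsupp.equivFunOnFinite.symm (γ + Pi.single i 1 + Pi.single j 1)) P) *ᵥ w) =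
      MvPolynomial.eval (v + w) (L.foldr (fun l g => MvPolynomial.pderiv l g) P) -
        MvPolynomial.eval v (L.foldr (fun l g => MvPolynomial.pderiv l g) P) -
        MvPolynomial.eval w (L.foldr (fun l g => MvPolynomial.pderiv l g) P) := by
  have hQ : (L.foldr (fun l g => MvPolynomial.pderiv l g) P).IsHomogeneous 2 :=
    isHomogeneous_foldr_pderiv L 2 P (by rwa [add_comm])
  rw [polarization_eq hQ]
  simp only [dotProduct, Matrix.mulVec]
  refine Finset.sum_congr rfl fun i _ => ?_
  rw [Finset.mul_sum]
  refine Finset.sum_congr rfl fun j _ => ?_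
  rw [hessEntry_eq_coeff_foldr_pderiv P L γ hγ i j]
  ring

/-- … and on the diagonal `vᵀ (hessAt c γ) v = 2 Q(v)` (Euler). [folklore] -/
theorem dotProduct_hessAt_mulVec_self (P : MvPolynomial (Fin K) ℝ) (L : List (Fin K)) (γ : Fin K → ℕ)
    (hγ : ∀ a, L.count a = γ a) (hP : P.IsHomogeneous (L.length + 2)) (v : Fin K → ℝ) :
    v ⬝ᵥ ((fun i j : Fin K =>
        ((∏ k, ((γ + Pi.single i 1 + Pi.single j 1 : Fin K → ℕ) k).factorial : ℕ) : ℝ) *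
          MvPolynomial.coeff (Finsupp.equivFunOnFinite.symm (γ + Pi.single i 1 + Pi.single j 1)) P) *ᵥ v) =
      2 * MvPolynomial.eval v (L.foldr (fun l g => MvPolynomial.pderiv l g) P) := by
  have hQ : (L.foldr (fun l g => MvPolynomial.pderiv l g) P).IsHomogeneous 2 :=
    isHomogeneous_foldr_pderiv L 2 P (by rwa [add_comm])
  rw [dotProduct_hessAt_mulVec P L γ hγ hP v v, ← two_smul ℝ v,
    DetLorentzianHyperbolicQuadratic.eval_smul_two hQ]
  ring

end DetLorentzianHessianPderiv

end Summit.ValiantsHypothesis.ValiantsHypothesis.Theorems.LacunarySymmetroidMatrixDescartes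

end
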